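import Summits.Ventures.HSemireg.WedgeHankelRecurrenceGaussChebyshevUResultantZeroIff

/-!
# Venture HSemireg — **`T_d` IS A COMMON FACTOR OF `T_{kd}` AND `T_{ld}` FOR ODD `k`, `l`** (Mathlib's Chebyshev polynomials): by N433 (`T_d ∣ T_{(2j+1)d}`), so over a field with `2 ≠ 0` and `d ≥ 1`
# **`T_{kd}`, `T_{ld}` are NOT coprime**, **`Res_{(kd, ld)}(T_{kd}, T_{ld}) = 0` over `ℤ`** (common factor of positive degree, N439), and `cos(π∕(2d))` is a common real zero — the «both quotients
# odd» half of the Dilcher–Stolarsky ∕ Rayes–Trevisan–Wang criterion `gcd(T_m, T_n) ≠ 1 ⟺ m∕gcd, n∕gcd` both odd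

HONEST FRAMING. Part of the Lean index of the computation cell `pub-hsemireg` (seat p10 gen 47, Sunday typer «UNIFORM-IN-n»).  Polynomial algebra and one trigonometric evaluation only; no variety,
no cohomology theory, no sheaf, no Ext group and no semiregularity map is constructed here; nothing here says that HC / HC_CM / HC_AV holds; no Literature fact (unproved `Prop`) is declared or used.
Custodian versions as in `WedgeHankelSiegelIdeal` (1/3).
SOURCES (cited).  K. Dilcher, K. B. Stolarsky, Trans. Amer. Math. Soc. 357 (2005) 965–981, Thm 2; M. O. Rayes, V. Trevisan, P. S. Wang, Comput. Math. Appl. 50 (2005) 1231–1240, Thm 4 (`gcd(T_m,T_n)`);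
T. J. Rivlin, *Chebyshev Polynomials* (1990), Ex. 1.5.  One direction of the criterion is the COROLLARY typed here; the converse (coprimality when the `2`-adic valuations differ) is not typed.
PROOF TYPED HERE.  N433 `chebyshevT_dvd_T_odd_mul`; Mathlib `IsCoprime.isUnit_of_dvd'`, `natDegree_eq_zero_of_isUnit`, `natDegree_T`, `T_ne_zero`, `T_real_cos`; N439 `resultant_eq_zero_of_common_factor`.
DEDUP DISCLOSURE (`rg -n -i 'T_not_isCoprime|odd_mul_odd_mul' Summits/Ventures/HSemireg`, 2026-09-04): N433 (`k` odd, `l = 1`), N434 (`d = 1`); 0 hits for the 4 names below.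

WHAT IS IN THE TREE.  N433, N434, N439, N446 (`IsCoprime T_{n+1} T_n`), N450 (`IsCoprime T_{n+2} T_n ⟺ n` even).
THIS FILE (namespace `Summit.Ventures.HSemireg.Wedge.HankelOuter` continued; CHAINED on N454; 0 definitions):
* §1220 `chebyshevT_not_isUnit` (`d ≥ 1`), **`chebyshevT_not_isCoprime_odd_mul`**, **`chebyshevT_resultant_odd_mul_odd_mul`** (`= 0`), `chebyshevT_common_real_zero_odd_mul` (`cos(π∕(2d))`).
CAVEATS.  Only the non-coprimality half of the `gcd` criterion.  Nothing Ext-side.  New names only.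
-/

open Module Polynomial Real
open scoped Matrix Polynomial

namespace Summit.Ventures.HSemireg.Wedge.HankelOuter

/-! ## §1220. `T_d` as a common factor -/

/-- `T_d` is not a unit for `d ≥ 1` (field with `2 ≠ 0`: `deg T_d = d`). [bookkeeping; this file, §1220] -/
theorem chebyshevT_not_isUnit {K : Type*} [Field K] (h2 : (2 : K) ≠ 0) {d : ℕ} (hd : 1 ≤ d) : ¬ IsUnit (Polynomial.Chebyshev.T K (d : ℤ)) := by
  haveI : NeZero (2 : K) := ⟨h2⟩
  intro h
  have hdeg := Polynomial.natDegree_eq_zero_of_isUnit h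
  rw [Polynomial.Chebyshev.natDegree_T, Int.natAbs_natCast] at hdeg
  omega

/-- **Odd `k`, `l` and `d ≥ 1`: `T_{kd}` and `T_{ld}` are not coprime** (common factor `T_d`; field with `2 ≠ 0`). [Rayes–Trevisan–Wang 2005 Thm 4 (one direction); this file, §1220] -/
theorem chebyshevT_not_isCoprime_odd_mul {K : Type*} [Field K] (h2 : (2 : K) ≠ 0) {k l : ℤ} (hk : Odd k) (hl : Odd l) {d : ℕ} (hd : 1 ≤ d) :
    ¬ IsCoprime (Polynomial.Chebyshev.T K (k * d)) (Polynomial.Chebyshev.T K (l * d)) := fun h =>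
  chebyshevT_not_isUnit h2 hd (h.isUnit_of_dvd' (chebyshevT_dvd_T_odd_mul hk (d : ℤ)) (chebyshevT_dvd_T_odd_mul hl (d : ℤ)))

/-- **Odd `k`, `l`, `d ≥ 1`: `Res_{(kd, ld)}(T_{kd}, T_{ld}) = 0` over `ℤ`.** [Dilcher–Stolarsky 2005 Thm 2 (vanishing part); this file, §1220] -/
theorem chebyshevT_resultant_odd_mul_odd_mul {k l : ℕ} (hk : Odd k) (hl : Odd l) {d : ℕ} (hd : 1 ≤ d) :
    (Polynomial.Chebyshev.T ℤ ((k * d : ℕ) : ℤ)).resultant (Polynomial.Chebyshev.T ℤ ((l * d : ℕ) : ℤ)) (k * d) (l * d) = 0 := by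
  have hdk : Polynomial.Chebyshev.T ℤ (d : ℤ) ∣ Polynomial.Chebyshev.T ℤ ((k * d : ℕ) : ℤ) := by
    rw [Nat.cast_mul]; exact chebyshevT_dvd_T_odd_mul (Odd.natCast hk) (d : ℤ)
  have hdl : Polynomial.Chebyshev.T ℤ (d : ℤ) ∣ Polynomial.Chebyshev.T ℤ ((l * d : ℕ) : ℤ) := by
    rw [Nat.cast_mul]; exact chebyshevT_dvd_T_odd_mul (Odd.natCast hl) (d : ℤ)
  have hdeg : ∀ j : ℕ, (Polynomial.Chebyshev.T ℤ (j : ℤ)).natDegree = j := fun j => by rw [Polynomial.Chebyshev.natDegree_T, Int.natAbs_natCast]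
  exact resultant_eq_zero_of_common_factor hdk hdl (by rw [hdeg]; omega) (Polynomial.Chebyshev.T_ne_zero ℤ _) (Polynomial.Chebyshev.T_ne_zero ℤ _) (hdeg _).le (hdeg _).le

/-- **Odd `k`, `l`, `d ≥ 1`: `cos(π∕(2d))` is a common real zero of `T_{kd}` and `T_{ld}`.** [Rivlin Ex. 1.5; this file, §1220] -/
theorem chebyshevT_common_real_zero_odd_mul {k l : ℤ} (hk : Odd k) (hl : Odd l) {d : ℕ} (hd : 1 ≤ d) :
    (Polynomial.Chebyshev.T ℝ (k * d)).eval (cos (π / (2 * d))) = 0 ∧ (Polynomial.Chebyshev.T ℝ (l * d)).eval (cos (π / (2 * d))) = 0 := by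
  have hd0 : (0 : ℝ) < d := by exact_mod_cast hd
  have hzero : (Polynomial.Chebyshev.T ℝ (d : ℤ)).eval (cos (π / (2 * d))) = 0 := by
    rw [Polynomial.Chebyshev.T_real_cos, show ((d : ℤ) : ℝ) * (π / (2 * d)) = π / 2 by push_cast; field_simp, Real.cos_pi_div_two]
  exact ⟨eval_eq_zero_of_dvd_of_eval_eq_zero (chebyshevT_dvd_T_odd_mul hk (d : ℤ)) hzero, eval_eq_zero_of_dvd_of_eval_eq_zero (chebyshevT_dvd_T_odd_mul hl (d : ℤ)) hzero⟩

end Summit.Ventures.HSemireg.Wedge.HankelOuter
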